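import Literature.AlgebraicGeometry.HodgeTheory.CyclicCoverUniversalFamily
import Literature.AlgebraicGeometry.HodgeTheory.UniversalHypersurfaceDiscriminantExists
import Literature.AlgebraicGeometry.HodgeTheory.HypersurfaceComplexPoints
import Literature.AlgebraicGeometry.Motives.UniversalHypersurfaceBaseChart
import Literature.AlgebraicGeometry.FundamentalGroup.HypersurfaceComplementMeridians
import HarnessLib

/-!
# The base of the Carlson–Toledo family of cyclic covers IS the complement of the discriminant of plane
# curves: the coefficient chart `S(ℂ) ≃ₜ {Disc ≠ 0}` (Carlson–Toledo 1999 §2: "`Ũ = ℂ^{N+1} − Δ̃`, where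
# `Δ̃` is the pre-image of `Δ`")

Family `hodge`, layer `Literature/AlgebraicGeometry/HodgeTheory`; theorems only (no definition, no named fact).
Written by the prover seat `hodge-nonav-prover-Bx` (g8) for crux K1 of the route `CyclicUnitaryPowers` (Hodge
summit): the TOPOLOGICAL presentation of the base `S = cyclicCoverBase p` of the constructed universal family
`cyclicCoverFamily p` of smooth `p`-cyclic covers `V(x₃^p − f) ⊂ ℙ³` of `ℙ²` (`CyclicCoverUniversalFamily`) to
which the tree's Zariski–van Kampen theorems (`FundamentalGroup/HypersurfaceComplementMeridians*`: `π₁` of the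
complement of an irreducible affine hypersurface is normally generated by one meridian; meridians are conjugate)
apply — the route-A counterpart of `SignSymmetricPowersMeridianChart` (route B, base `S_M`).

* §1 `isNonsingularForm_cyclicCoverForm_iff` — **`x₃^p − f` is nonsingular iff the ternary form `f` is**
  (`p ≥ 2`; gradient `(−∇f, p x₃^{p−1})`): the discriminant `Δ̃` of the cyclic family is the discriminant of
  plane curves of degree `p` ("the pre-image of `Δ`").
* §2 `exists_irreducible_discriminantEquation` — hence an IRREDUCIBLE polynomial `D ∈ ℂ[b_e]` with
  `{D = 0} = {b | x₃^p − f_b singular}` (the tree's proved ternary discriminant,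
  `exists_irreducible_discriminantForm` with `n = 1`).
* §3 the coefficient chart `t ↦ (coeff_e f_t)_e`, `S(ℂ) → ℂ^{TernaryIndex p}`: continuous, injective, an
  EMBEDDING (`isEmbedding_coeffChart`: through the closed immersion `S ↪ U` and the open embedding
  `U(ℂ) ↪ ℂ^{DegIndex 2 p}`), with image `{b | x₃^p − f_b nonsingular}` (`range_coeffChart`); whence
  **`exists_homeomorph_affineHypersurfaceComplement`**: for any equation `D` of `Δ̃` a homeomorphism
  `χ : S(ℂ) ≃ₜ affineHypersurfaceComplement ![D]` reading the coefficients of the branch form — the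
  `IsCoefficientChart` input of the meridian facts of `CyclicCoverMeridianMonodromy`.

## References

* [CarlsonToledo1999] J. A. Carlson, D. Toledo, Discriminant complements and kernels of monodromy
  representations, Duke Math. J. 97 (1999), §2 (held text p0004: `Ũ = ℂ^{N+1} − Δ̃`), §3 (p0007: irreducibility
  of the discriminant).
* [SerreGAGA1956] J.-P. Serre, Géométrie algébrique et géométrie analytique, §2 n°5 (analytic topology of
  points of an open subscheme of affine space).
* [Hartshorne1977] R. Hartshorne, Algebraic Geometry, I Ex. 5.8 (Jacobian criterion for forms).
-/

noncomputable section

namespace Literature.AlgebraicGeometry.HodgeTheory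

open CategoryTheory MvPolynomial _root_.Topology
open Literature.AlgebraicGeometry.Motives Literature.AlgebraicGeometry.Motives.UniversalHypersurface
open Literature.AlgebraicGeometry.Motives.SmoothHypersurface (IsNonsingularForm)
open Literature.AlgebraicGeometry.HodgeTheory.UniversalHypersurface
open Literature.AlgebraicGeometry.FundamentalGroup

/-! ### §1 `x₃^p − f` is nonsingular iff `f` is -/

section Nonsingular

variable {p : ℕ} {f : MvPolynomial (Fin 3) ℂ}

/-- `∂/∂x_j (x₃^p − f) = −∂f/∂x_j` for `j < 3`. [cite: Hartshorne1977, I Ex. 5.8] -/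
theorem pderiv_castSucc_cyclicCoverForm (j : Fin 3) :
    pderiv (Fin.castSucc j) (cyclicCoverForm p f) = -rename Fin.castSucc (pderiv j f) := by
  rw [cyclicCoverForm_def, map_sub, Derivation.leibniz_pow, pderiv_X_of_ne (Fin.castSucc_lt_last j).ne',
    smul_zero, smul_zero, zero_sub, pderiv_rename (Fin.castSucc_injective 3)]

/-- `∂/∂x₃ (x₃^p − f) = p x₃^{p−1}`. [cite: Hartshorne1977, I Ex. 5.8] -/
theorem pderiv_last_cyclicCoverForm :
    pderiv (Fin.last 3) (cyclicCoverForm p f) =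
      (p : MvPolynomial (Fin 4) ℂ) * X (Fin.last 3) ^ (p - 1) := by
  classical
  have h0 : pderiv (Fin.last 3) (rename Fin.castSucc f) = 0 := by
    refine pderiv_eq_zero_of_notMem_vars fun h => ?_
    obtain ⟨j, -, hj⟩ := Finset.mem_image.mp (vars_rename Fin.castSucc f h)
    exact (Fin.castSucc_lt_last j).ne hj
  rw [cyclicCoverForm_def, map_sub, h0, sub_zero, Derivation.leibniz_pow, pderiv_X_self]
  simp [nsmul_eq_mul]

/-- `(x₃^p − f)(x, t) = t^p − f(x)` on a vector written as `Fin.snoc x t`. [folklore] -/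
private theorem eval_snoc_rename (x : Fin 3 → ℂ) (t : ℂ) (g : MvPolynomial (Fin 3) ℂ) :
    eval (Fin.snoc x t : Fin 4 → ℂ) (rename Fin.castSucc g) = eval x g := by
  have h : ((Fin.snoc x t : Fin 4 → ℂ) ∘ Fin.castSucc) = x :=
    funext fun i => Fin.snoc_castSucc (α := fun _ => ℂ) (p := x) (x := t) (i := i)
  rw [eval_rename, h]

/-- **`x₃^p − f` is a nonsingular quaternary form iff `f` is a nonsingular ternary form** (`p ≥ 2`): a common
zero `(x, x₃) ≠ 0` of `x₃^p − f` and its gradient `(−∇f(x), p x₃^{p−1})` has `x₃ = 0`, hence `x ≠ 0`,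
`f(x) = 0`, `∇f(x) = 0`; conversely a singular point `x` of `V(f)` gives the singular point `(x, 0)`. So the
discriminant `Δ̃` of the cyclic family is "the pre-image of `Δ`", the discriminant of plane curves of degree `p`.
[cite: CarlsonToledo1999, §2 (held text p0004)] [cite: Hartshorne1977, I Ex. 5.8] -/
theorem isNonsingularForm_cyclicCoverForm_iff (hp : 2 ≤ p) :
    IsNonsingularForm ℂ (cyclicCoverForm p f) ↔ IsNonsingularForm ℂ f := by
  rw [SmoothHypersurface.isNonsingularForm_iff_forall_exists_eval_pderiv_ne_zero,
    SmoothHypersurface.isNonsingularForm_iff_forall_exists_eval_pderiv_ne_zero]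
  have hp0 : p ≠ 0 := by omega
  have hp1 : p - 1 ≠ 0 := by omega
  constructor
  · intro hF x hx hfx
    by_contra hall
    push Not at hall
    have hz : (Fin.snoc x 0 : Fin 4 → ℂ) ≠ 0 := by
      intro h
      apply hx
      funext i
      have := congr_fun h (Fin.castSucc i)
      rwa [Fin.snoc_castSucc] at this
    have hFz : eval (Fin.snoc x 0 : Fin 4 → ℂ) (cyclicCoverForm p f) = 0 := by
      rw [CyclicCoverFormNonsingular.eval_snoc_cyclicCoverForm_eq, zero_pow hp0, hfx, sub_zero]
    obtain ⟨j, hj⟩ := hF _ hz hFz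
    refine hj ?_
    induction j using Fin.lastCases with
    | last =>
      rw [pderiv_last_cyclicCoverForm, map_mul, map_pow, eval_X, Fin.snoc_last, zero_pow hp1, mul_zero]
    | cast j => rw [pderiv_castSucc_cyclicCoverForm, map_neg, eval_snoc_rename, hall j, neg_zero]
  · intro hf z hz hFz
    by_contra hall
    push Not at hall
    set x : Fin 3 → ℂ := Fin.init z with hxdef
    set t : ℂ := z (Fin.last 3) with htdef
    have hzst : z = Fin.snoc x t := (Fin.snoc_init_self z).symm
    have hlast := hall (Fin.last 3)
    rw [pderiv_last_cyclicCoverForm, map_mul, map_pow, eval_X, map_natCast] at hlast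
    have ht : t = 0 := by
      rcases mul_eq_zero.mp hlast with h | h
      · exact absurd h (Nat.cast_ne_zero.mpr hp0)
      · exact pow_eq_zero_iff hp1 |>.mp h
    have hfx : eval x f = 0 := by
      rw [hzst, CyclicCoverFormNonsingular.eval_snoc_cyclicCoverForm_eq, ht, zero_pow hp0, zero_sub, neg_eq_zero] at hFz
      exact hFz
    have hx : x ≠ 0 := by
      intro h
      apply hz
      rw [hzst, h, ht]
      funext i
      induction i using Fin.lastCases with
      | last => exact Fin.snoc_last (α := fun _ => ℂ) (x := (0 : ℂ)) (p := (0 : Fin 3 → ℂ))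
      | cast i => exact Fin.snoc_castSucc (α := fun _ => ℂ) (x := (0 : ℂ)) (p := (0 : Fin 3 → ℂ)) (i := i)
    obtain ⟨j, hj⟩ := hf x hx hfx
    refine hj ?_
    have h := hall (Fin.castSucc j)
    rwa [pderiv_castSucc_cyclicCoverForm, map_neg, neg_eq_zero, hzst, eval_snoc_rename] at h

end Nonsingular

/-! ### §2 The ternary branch form of a coefficient vector; an irreducible equation of `Δ̃` -/

section Discriminant

variable (p : ℕ)

/-- The coefficients of `f_b = Σ_e b_e x^e` are the `b_e`. [cite: CarlsonToledo1999, §2 (held text p0004)] -/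
theorem coeff_sum_monomial (b : TernaryIndex p → ℂ) (e : TernaryIndex p) :
    (∑ e' : TernaryIndex p, monomial e'.1 (b e')).coeff e.1 = b e := by
  classical
  rw [coeff_sum]
  simp only [coeff_monomial]
  rw [Finset.sum_eq_single e (fun e' _ he' => if_neg fun h => he' (Subtype.ext h))
    (fun h => absurd (Finset.mem_univ _) h), if_pos rfl]

/-- `f_b` is homogeneous of degree `p`. [cite: CarlsonToledo1999, §2 (held text p0004)] -/
theorem isHomogeneous_sum_monomial (b : TernaryIndex p → ℂ) :
    (∑ e : TernaryIndex p, monomial e.1 (b e)).IsHomogeneous p :=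
  IsHomogeneous.sum _ _ _ fun e _ => isHomogeneous_monomial _ e.2

/-- The branch form of a point is the form of its coefficient vector: `f_t = Σ_e (coeff_e f_t) x^e`.
[cite: CarlsonToledo1999, §2 (held text p0004)] -/
theorem sum_monomial_coeff_branchForm (t : ComplexPoints (cyclicCoverBase p)) :
    ∑ e : TernaryIndex p, monomial e.1 ((branchForm p t).coeff e.1) = branchForm p t := by
  unfold branchForm
  refine Finset.sum_congr rfl fun e _ => ?_
  rw [← coeff_branchForm]
  rfl

/-- The tree's `formOfCoeffs` for plane curves of degree `p` (`n = 1`) is the ternary form `Σ_e b_e x^e`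
(same index type `{e : Fin 3 →₀ ℕ // |e| = p}`). [folklore] -/
private theorem formOfCoeffs_eq_sum (b : TernaryIndex p → ℂ) :
    formOfCoeffs (n := 1) (d := p) b = ∑ e : TernaryIndex p, monomial e.1 (b e) := rfl

/-- **An irreducible equation of the discriminant of the cyclic family** (`p ≥ 2`): an irreducible
`D ∈ ℂ[b_e]` with `D(b) = 0 ↔ x₃^p − f_b singular`, namely the discriminant of plane curves of degree `p`
(irreducible: dual of the Veronese surface; the tree's `exists_irreducible_discriminantForm`), by §1.
[cite: CarlsonToledo1999, §3 (held text p0007) and §2 (p0004)] -/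
theorem exists_irreducible_discriminantEquation (hp : 2 ≤ p) :
    ∃ D : MvPolynomial (TernaryIndex p) ℂ, Irreducible D ∧
      ∀ b : TernaryIndex p → ℂ, eval b D = 0 ↔
        ¬ IsNonsingularForm ℂ (cyclicCoverForm p (∑ e : TernaryIndex p, monomial e.1 (b e))) := by
  obtain ⟨D, hirr, hD⟩ := exists_irreducible_discriminantForm (n := 1) (d := p) hp
  refine ⟨D, hirr, fun b => ?_⟩
  rw [← hD b, mem_singularCoeffs_iff, formOfCoeffs_eq_sum, isNonsingularForm_cyclicCoverForm_iff hp]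

end Discriminant

/-! ### §3 The coefficient chart of `S(ℂ)` -/

section Chart

variable (p : ℕ)

/-- The coefficient chart reads `ψ_t(b_e)`. [cite: CarlsonToledo1999, §2 (held text p0004)] -/
theorem coeffChart_apply (t : ComplexPoints (cyclicCoverBase p)) (e : TernaryIndex p) :
    (branchForm p t).coeff e.1 = pointAlgHomSpz ℂ 2 p (cyclicCoverSpz p) t (X e) :=
  coeff_branchForm p t e

/-- **The coefficient chart is injective**: a point of `S(ℂ)` is determined by its coefficient homomorphism
(`pointHomSpz_injective`), which is determined by its values `coeff_e f_t` on the variables.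
[cite: SerreGAGA1956, §2 n°5] -/
theorem coeffChart_injective :
    Function.Injective fun t : ComplexPoints (cyclicCoverBase p) => fun e : TernaryIndex p =>
      (branchForm p t).coeff e.1 := by
  intro t t' h
  apply pointHomSpz_injective ℂ 2 p (cyclicCoverSpz p)
  rw [← ofHom_pointAlgHomSpz, ← ofHom_pointAlgHomSpz]
  congr 2
  refine MvPolynomial.algHom_ext fun e => ?_
  have := congr_fun h e
  simp only [coeffChart_apply] at this
  exact this

/-- The coordinate `b ↦ coeff_m (x₃^p − f_b)` of the quaternary coefficient vector is a continuous (indeed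
affine-linear) function of the ternary coefficient vector `b`. [folklore] -/
private theorem continuous_coeff_cyclicCoverForm_sum (m : DegIndex 2 p) :
    Continuous fun b : TernaryIndex p → ℂ =>
      (cyclicCoverForm p (∑ e : TernaryIndex p, monomial e.1 (b e))).coeff m.1 := by
  classical
  have h : ∀ b : TernaryIndex p → ℂ, (cyclicCoverForm p (∑ e : TernaryIndex p, monomial e.1 (b e))).coeff m.1 =
      (X (Fin.last 3) ^ p : MvPolynomial (Fin 4) ℂ).coeff m.1 -
        ∑ e : TernaryIndex p, if Finsupp.mapDomain Fin.castSucc e.1 = m.1 then b e else 0 := by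
    intro b
    rw [cyclicCoverForm_def, coeff_sub, map_sum, coeff_sum]
    congr 1
    refine Finset.sum_congr rfl fun e _ => ?_
    rw [rename_monomial, coeff_monomial]
  simp_rw [h]
  refine continuous_const.sub (continuous_finsetSum _ fun e _ => ?_)
  split_ifs
  · exact continuous_apply e
  · exact continuous_const

/-- **The quaternary coefficient vector of the image point factors through the ternary chart**:
`coeffVector [x₃^p − f_t] m = coeff_m (x₃^p − f_{b(t)})`, `b(t) = (coeff_e f_t)_e`.
[cite: CarlsonToledo1999, §2 (universalcyclic) (held text p0004)] -/
theorem coeffVector_map_toBaseSpz [NeZero p] (t : ComplexPoints (cyclicCoverBase p)) (m : DegIndex 2 p) :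
    coeffVector ℂ 2 p (AlgPoints.map (toBaseSpz ℂ 2 p (cyclicCoverSpz p)) t) m =
      (cyclicCoverForm p (∑ e : TernaryIndex p, monomial e.1 ((branchForm p t).coeff e.1))).coeff m.1 := by
  rw [sum_monomial_coeff_branchForm, cyclicCoverForm_branchForm, coeffVector_apply]

/-- **The coefficient chart `S(ℂ) → ℂ^{TernaryIndex p}` is a topological embedding**: it is injective, and
followed by the continuous map `b ↦ (coeff_m (x₃^p − f_b))_m` it becomes the embedding
`S(ℂ) ↪ U(ℂ) ↪ ℂ^{DegIndex 2 p}` (closed immersion `S ↪ U`, `AlgPoints.isEmbedding_map_of_isClosedImmersion`;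
open chart of `U`, `isEmbedding_coeffVector`). [cite: SerreGAGA1956, §2 n°5] -/
theorem isEmbedding_coeffChart [NeZero p] :
    IsEmbedding fun t : ComplexPoints (cyclicCoverBase p) => fun e : TernaryIndex p =>
      (branchForm p t).coeff e.1 := by
  haveI := isClosedImmersion_toBaseSpz_left ℂ 2 p (cyclicCoverSpz p) (cyclicCoverSpz_surjective p (NeZero.ne p))
  have hE : IsEmbedding fun t : ComplexPoints (cyclicCoverBase p) =>
      coeffVector ℂ 2 p (AlgPoints.map (toBaseSpz ℂ 2 p (cyclicCoverSpz p)) t) :=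
    (isEmbedding_coeffVector ℂ 2 p).comp
      (AlgPoints.isEmbedding_map_of_isClosedImmersion (toBaseSpz ℂ 2 p (cyclicCoverSpz p)))
  let A : (TernaryIndex p → ℂ) → (DegIndex 2 p → ℂ) := fun b m =>
    (cyclicCoverForm p (∑ e : TernaryIndex p, monomial e.1 (b e))).coeff m.1
  have hA : Continuous A := continuous_pi fun m => continuous_coeff_cyclicCoverForm_sum p m
  have hcomp : (fun t : ComplexPoints (cyclicCoverBase p) =>
      coeffVector ℂ 2 p (AlgPoints.map (toBaseSpz ℂ 2 p (cyclicCoverSpz p)) t)) =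
      A ∘ fun t : ComplexPoints (cyclicCoverBase p) => fun e : TernaryIndex p => (branchForm p t).coeff e.1 := by
    funext t
    funext m
    exact coeffVector_map_toBaseSpz p t m
  have hcont : Continuous fun t : ComplexPoints (cyclicCoverBase p) => fun e : TernaryIndex p =>
      (branchForm p t).coeff e.1 := by
    refine continuous_pi fun e => ?_
    have hfun : (fun t : ComplexPoints (cyclicCoverBase p) => (branchForm p t).coeff e.1) =
        fun t => -coeffVector ℂ 2 p (AlgPoints.map (toBaseSpz ℂ 2 p (cyclicCoverSpz p)) t) (extendIndex e) := by
      funext t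
      rw [coeffVector_apply, coeff_pointFormSpz, cyclicCoverSpz_X_extendIndex p (NeZero.ne p), map_neg,
        neg_neg, coeffChart_apply, pointAlgHomSpz_apply]
    rw [hfun]
    exact ((continuous_apply (extendIndex e)).comp
      ((continuous_coeffVector ℂ 2 p).comp (AlgPoints.continuous_map _))).neg
  rw [hcomp] at hE
  exact ⟨IsInducing.of_comp hcont hA hE.isInducing, coeffChart_injective p⟩

/-- **The image of the coefficient chart is the set of nonsingular parameters**
`{b | x₃^p − f_b nonsingular} = ℂ^{N+1} − Δ̃`: every point has nonsingular form, and every such `b` is the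
chart of the classifying point `[x₃^p − f_b]` (`cyclicCoverPoint`). [cite: CarlsonToledo1999, §2 (held text p0004)] -/
theorem range_coeffChart [NeZero p] :
    Set.range (fun t : ComplexPoints (cyclicCoverBase p) => fun e : TernaryIndex p => (branchForm p t).coeff e.1) =
      {b | IsNonsingularForm ℂ (cyclicCoverForm p (∑ e : TernaryIndex p, monomial e.1 (b e)))} := by
  ext b
  constructor
  · rintro ⟨t, rfl⟩
    rw [Set.mem_setOf_eq, sum_monomial_coeff_branchForm, cyclicCoverForm_branchForm]
    exact isNonsingularForm_pointForm ℂ 2 p _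
  · intro hb
    rw [Set.mem_setOf_eq] at hb
    have hf := isHomogeneous_sum_monomial p b
    refine ⟨cyclicCoverPoint p (∑ e : TernaryIndex p, monomial e.1 (b e)), funext fun e => ?_⟩
    change (branchForm p (cyclicCoverPoint p (∑ e : TernaryIndex p, monomial e.1 (b e)))).coeff e.1 = b e
    rw [coeffChart_apply, cyclicCoverPoint_eq p hf hb, pointAlgHomSpz_apply, pointHomSpz_pointOfFormSpz,
      CommRingCat.hom_ofHom, AlgHom.toRingHom_eq_coe, AlgHom.coe_toRingHom, ternaryCoeffHom_X,
      coeff_sum_monomial]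

/-- **The coefficient chart of the base of the Carlson–Toledo family**: for every equation `D` of the
discriminant (`D(b) = 0 ↔ x₃^p − f_b` singular) there is a homeomorphism
`χ : S(ℂ) ≃ₜ affineHypersurfaceComplement ![D] = {D ≠ 0} ⊂ ℂ^{TernaryIndex p}` reading the coefficients
`coeff_e f_t` of the branch form ("`Ũ = ℂ^{N+1} − Δ̃`" as topological spaces) — the `IsCoefficientChart` datum
of the meridian facts, to which the Zariski–van Kampen theorems of
`FundamentalGroup/HypersurfaceComplementMeridians*` apply when `D` is irreducible
(`exists_irreducible_discriminantEquation`). [cite: CarlsonToledo1999, §2 (held text p0004)]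
[cite: SerreGAGA1956, §2 n°5] -/
theorem exists_homeomorph_affineHypersurfaceComplement [NeZero p] {D : MvPolynomial (TernaryIndex p) ℂ}
    (hD : ∀ b : TernaryIndex p → ℂ, eval b D = 0 ↔
      ¬ IsNonsingularForm ℂ (cyclicCoverForm p (∑ e : TernaryIndex p, monomial e.1 (b e)))) :
    ∃ χ : ComplexPoints (cyclicCoverBase p) ≃ₜ affineHypersurfaceComplement ![D],
      ∀ (t : ComplexPoints (cyclicCoverBase p)) (e : TernaryIndex p),
        (χ t : TernaryIndex p → ℂ) e = (branchForm p t).coeff e.1 := by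
  have hE := isEmbedding_coeffChart p
  have hrange : Set.range (fun t : ComplexPoints (cyclicCoverBase p) => fun e : TernaryIndex p =>
      (branchForm p t).coeff e.1) = affineHypersurfaceComplement ![D] := by
    rw [range_coeffChart]
    ext b
    simp only [Set.mem_setOf_eq, mem_affineHypersurfaceComplement_iff, Fin.forall_fin_one,
      Matrix.cons_val_zero]
    rw [Ne, hD, not_not]
  refine ⟨hE.toHomeomorph.trans (Homeomorph.setCongr hrange), fun t e => ?_⟩
  rw [Homeomorph.trans_apply]
  change ((hE.toHomeomorph t : TernaryIndex p → ℂ)) e = _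
  rw [Topology.IsEmbedding.toHomeomorph_apply_coe]

end Chart

end Literature.AlgebraicGeometry.HodgeTheory

end
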